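import Mathlib.Algebra.BigOperators.Group.Finset.Basic
import Mathlib.Algebra.Module.Defs
import Mathlib.Tactic.Abel
import Mathlib.Tactic.Ring

/-!
# `BalabanUV.Beta.GAN24.AffineUnroll` — binder row G-an2-4 / (CONV-C), W-slot, road «W3» (F1)/(F5): THE DISCRETE DUHAMEL ENGINE
# (the n-level unrolling of an affine recursion whose linear maps are additive ONLY ON A CLASS; G-an2-4 FORMAL swarm, leaf-01 lineage,
# gen 14; part 1 of «W3-L1 T2SPLIT*» — the order-4 twin of this lineage's `E3UnitSplitLevels/Sum`, generic part)

NOT IN PRINT; OUR BOOKKEEPING.  HONEST FRAMING (cell contract, verbatim): «discharging `BetaPertH` makes Bałaban's UV stability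
UNCONDITIONAL — a real constructive-QFT result; it is NOT the continuum limit and NOT the Clay problem.»  HONEST DEPENDENCY (verbatim):
«continuum YM on T⁴ ⇐ BetaPertH ∧ nine spine estimates (0/9 proved); BetaPertH ⇐ (D1) ∧ (D4) ∧ CAP+tail; G-an2-4 gates asym, D1 and
NE2/3/4.»

WHY.  Road «W3» for the located remainder «T2Shape» ∧ «T2SupRate» of the W-slot (row owner gan24-p1, `SKELETON-W3.md` v0.2 §1.2, §7.4)
rests on the AFFINE SPLIT of the normalised second-order recursion, `T̃₂(j+1) = 𝒜_j[T̃₂(j)] + b_j` (leaf-04's `T2RecursionAffine.unitS₂_T2Of_succ_affine`,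
`𝒜_j = lin4 (cE₂·Lc^{2(d+1)}) K♮_j Lc`), UNROLLED over `n` levels: `T̃₂(n) = 𝒜_{n−1}⋯𝒜_0[T̃₂(0)] + Σ_{m<n} 𝒜_{n−1}⋯𝒜_{m+1}[b_m]` ((F1)), and on
the same unrolling for the DIFFERENCE recursion `D(n+1) = 𝒜_{n+1}[D(n)] + f_n` ((F5), «T2SupRate»).  The maps `𝒜_j` are `tsum`-built
(`vertex2OfK`, `comp`), hence ADDITIVE ONLY on summable — e.g. `LocStencil₂` — tables.  This module is the an2-free, push₄-free ALGEBRA of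
that unrolling: an affine recursion in an additive commutative group `E` whose maps `A j : E → E` are additive on a class `P` closed under
`+`, `−`, containing `0`, preserved by every `A j`, and containing the initial datum and the sources.

WHAT ([folklore]; one plumbing `def`):
§1 `transport A m k = A (m+k−1) ∘ ⋯ ∘ A m` (the composite transport from level `m` through `k` steps; `transport_zero`/`_succ`/`_one`,
   right peel `transport_succ'`, `transport_trans`, reindexing `transport_shift`).
§2 on the class: `map_zero_of_add`, `map_sub_of_add`, `map_sum_of_add`, `transport_mem`, `transport_add`, `transport_sub`, `transport_sum`,
   and THE LEVEL SUM **`eq_transport_add_sum`**: `x n = transport A 0 n (x 0) + Σ_{m ∈ range n} transport A (m+1) (n−1−m) (b m)` — the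
   `E3UnitSplitSum.e3Of_succ_succ_decomp` shape one order up, every composite transport DISPLAYED; `mem_of_rec` (every member is in the class).
§3 scalars out (SKELETON-W3 (R12-3): no power of `cE₂` hidden): for `E` a module and maps `c • B j` with `B j` homogeneous on `P`,
   **`transport_smul_eq`**: `transport (fun j x ↦ c • B j x) m k x = c ^ k • transport B m k x`.
§4 THE DIFFERENCE RECURSION ((F5)): `D n := x (n+1) − x n` obeys **`diff_succ`**: `D (n+1) = A (n+1) (D n) + f n` with the FORCING
   **`f n := (A (n+1) (x n) − A n (x n)) + (b (n+1) − b n)`** (map difference on the previous member — the Lipschitz × Cauchy socket — plus source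
   difference), and **`diff_eq_transport_add_sum`**: `D n = transport A 1 n (D 0) + Σ_{m ∈ range n} transport A (m+2) (n−1−m) (f m)`.
Pure additive-group algebra: no estimate, no rate, no constant; asserts NOTHING about `T2Of`; discharges NOTHING of «T2Shape»/«T2SupRate»/(hW, hWall);
NOT «W-slot closed», NEVER «G-an2-4 closed»; NOT BetaPertH, NOT continuum, NOT Clay.
-/

open Finset
open scoped BigOperators

namespace Summit.QuantumFields.BalabanUV.Beta.GAN24.AffineUnroll

variable {E : Type*}

/-! ## §1 The composite transport -/

/-- [folklore] **THE COMPOSITE TRANSPORT** of a family of maps `A j : E → E`: `transport A m k = A (m+k−1) ∘ ⋯ ∘ A (m+1) ∘ A m`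
(`k` steps starting at level `m`; `k = 0` is the identity).  A plumbing definition asserting nothing. -/
def transport (A : ℕ → E → E) (m : ℕ) : ℕ → E → E
  | 0 => id
  | k + 1 => A (m + k) ∘ transport A m k

variable (A : ℕ → E → E)

/-- [folklore] Zero steps: the identity. -/
@[simp] theorem transport_zero (m : ℕ) (x : E) : transport A m 0 x = x := rfl

/-- [folklore] Left peel: `transport A m (k+1) = A (m+k) ∘ transport A m k`. -/
@[simp] theorem transport_succ (m k : ℕ) (x : E) : transport A m (k + 1) x = A (m + k) (transport A m k x) := rfl

/-- [folklore] One step: `transport A m 1 = A m`. -/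
theorem transport_one (m : ℕ) (x : E) : transport A m 1 x = A m x := by
  simp

/-- [folklore] Right peel: `transport A m (k+1) = transport A (m+1) k ∘ A m`. -/
theorem transport_succ' (m k : ℕ) (x : E) : transport A m (k + 1) x = transport A (m + 1) k (A m x) := by
  induction k with
  | zero => simp
  | succ k ih =>
    rw [transport_succ, ih, transport_succ]
    congr 1
    omega

/-- [folklore] Transitivity: `k + l` steps from `m` = `l` steps from `m + k` after `k` steps from `m`. -/
theorem transport_trans (m k l : ℕ) (x : E) : transport A m (k + l) x = transport A (m + k) l (transport A m k x) := by
  induction l with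
  | zero => simp
  | succ l ih =>
    rw [← Nat.add_assoc, transport_succ, ih, transport_succ, Nat.add_assoc]

/-- [folklore] Reindexing: the transport of the shifted family `j ↦ A (j + s)` from `m` is the transport of `A` from `m + s`. -/
theorem transport_shift (s m k : ℕ) (x : E) : transport (fun j => A (j + s)) m k x = transport A (m + s) k x := by
  induction k with
  | zero => simp
  | succ k ih =>
    rw [transport_succ, transport_succ, ih]
    congr 1
    omega

/-- [folklore] Pointwise congruence: families agreeing at the levels `m, …, m+k−1` have the same transport. -/
theorem transport_congr {A B : ℕ → E → E} (m k : ℕ) (h : ∀ i, i < k → ∀ x, A (m + i) x = B (m + i) x) (x : E) :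
    transport A m k x = transport B m k x := by
  induction k with
  | zero => simp
  | succ k ih =>
    rw [transport_succ, transport_succ, ih fun i hi => h i (Nat.lt_succ_of_lt hi), h k (Nat.lt_succ_self k)]

/-- [folklore] The transport preserves any class preserved by every map. -/
theorem transport_mem {A} {P : E → Prop} (hAP : ∀ j x, P x → P (A j x)) (m k : ℕ) {x : E} (hx : P x) :
    P (transport A m k x) := by
  induction k with
  | zero => simpa using hx
  | succ k ih => exact hAP _ _ ih

/-! ## §2 Additivity on a class and THE LEVEL SUM -/

section AddClass

variable [AddCommGroup E] {A} {P : E → Prop}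

/-- [folklore] A map additive on a class containing `0` kills `0`. -/
theorem map_zero_of_add {F : E → E} (hP0 : P 0) (hF : ∀ x y, P x → P y → F (x + y) = F x + F y) : F 0 = 0 := by
  have h := hF 0 0 hP0 hP0
  rw [add_zero] at h
  -- h : F 0 = F 0 + F 0
  have : F 0 + F 0 = F 0 + 0 := by rw [add_zero]; exact h.symm
  exact add_left_cancel this

/-- [folklore] A map additive on a class closed under subtraction is subtractive there. -/
theorem map_sub_of_add {F : E → E} (hPsub : ∀ x y, P x → P y → P (x - y))
    (hF : ∀ x y, P x → P y → F (x + y) = F x + F y) {x y : E} (hx : P x) (hy : P y) : F (x - y) = F x - F y := by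
  have h := hF (x - y) y (hPsub x y hx hy) hy
  rw [sub_add_cancel] at h
  rw [h, add_sub_cancel_right]

/-- [folklore] Finite sums of class members are class members. -/
theorem sum_mem {ι : Type*} (hP0 : P 0) (hPadd : ∀ x y, P x → P y → P (x + y)) (s : Finset ι) (g : ι → E)
    (hg : ∀ i ∈ s, P (g i)) : P (∑ i ∈ s, g i) := by
  classical
  induction s using Finset.induction_on with
  | empty => simpa using hP0
  | insert a s ha ih =>
    rw [Finset.sum_insert ha]
    exact hPadd _ _ (hg a (Finset.mem_insert_self a s)) (ih fun i hi => hg i (Finset.mem_insert_of_mem hi))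

/-- [folklore] A map additive on a class containing `0` and closed under `+` is additive over finite sums of class members. -/
theorem map_sum_of_add {ι : Type*} {F : E → E} (hP0 : P 0) (hPadd : ∀ x y, P x → P y → P (x + y))
    (hF : ∀ x y, P x → P y → F (x + y) = F x + F y) (s : Finset ι) (g : ι → E) (hg : ∀ i ∈ s, P (g i)) :
    F (∑ i ∈ s, g i) = ∑ i ∈ s, F (g i) := by
  classical
  induction s using Finset.induction_on with
  | empty => simpa using map_zero_of_add hP0 hF
  | insert a s ha ih =>
    have hga : P (g a) := hg a (Finset.mem_insert_self a s)
    have hgs : ∀ i ∈ s, P (g i) := fun i hi => hg i (Finset.mem_insert_of_mem hi)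
    rw [Finset.sum_insert ha, Finset.sum_insert ha, hF _ _ hga (sum_mem hP0 hPadd s g hgs), ih hgs]

/-- [folklore] The transport is additive on the class. -/
theorem transport_add (hAP : ∀ j x, P x → P (A j x))
    (hAadd : ∀ j x y, P x → P y → A j (x + y) = A j x + A j y) (m k : ℕ) {x y : E} (hx : P x) (hy : P y) :
    transport A m k (x + y) = transport A m k x + transport A m k y := by
  induction k with
  | zero => simp
  | succ k ih =>
    rw [transport_succ, transport_succ, transport_succ, ih,
      hAadd _ _ _ (transport_mem hAP m k hx) (transport_mem hAP m k hy)]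

/-- [folklore] The transport kills `0` (class containing `0`). -/
theorem transport_map_zero (hP0 : P 0)
    (hAadd : ∀ j x y, P x → P y → A j (x + y) = A j x + A j y) (m k : ℕ) : transport A m k (0 : E) = 0 := by
  induction k with
  | zero => simp
  | succ k ih => rw [transport_succ, ih, map_zero_of_add hP0 (hAadd (m + k))]

/-- [folklore] The transport is subtractive on the class (closed under `−`). -/
theorem transport_sub (hPsub : ∀ x y, P x → P y → P (x - y)) (hAP : ∀ j x, P x → P (A j x))
    (hAadd : ∀ j x y, P x → P y → A j (x + y) = A j x + A j y) (m k : ℕ) {x y : E} (hx : P x) (hy : P y) :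
    transport A m k (x - y) = transport A m k x - transport A m k y := by
  induction k with
  | zero => simp
  | succ k ih =>
    rw [transport_succ, transport_succ, transport_succ, ih,
      map_sub_of_add hPsub (hAadd (m + k)) (transport_mem hAP m k hx) (transport_mem hAP m k hy)]

/-- [folklore] The transport is additive over finite sums of class members. -/
theorem transport_sum {ι : Type*} (hP0 : P 0) (hPadd : ∀ x y, P x → P y → P (x + y)) (hAP : ∀ j x, P x → P (A j x))
    (hAadd : ∀ j x y, P x → P y → A j (x + y) = A j x + A j y) (m k : ℕ) (s : Finset ι) (g : ι → E)
    (hg : ∀ i ∈ s, P (g i)) : transport A m k (∑ i ∈ s, g i) = ∑ i ∈ s, transport A m k (g i) :=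
  map_sum_of_add hP0 hPadd (fun _ _ hx hy => transport_add hAP hAadd m k hx hy) s g hg

/-- [folklore] Every member of an affine recursion started and sourced in the class lies in the class. -/
theorem mem_of_rec (hPadd : ∀ x y, P x → P y → P (x + y)) (hAP : ∀ j x, P x → P (A j x)) {x b : ℕ → E}
    (hx0 : P (x 0)) (hb : ∀ j, P (b j)) (hrec : ∀ j, x (j + 1) = A j (x j) + b j) (n : ℕ) : P (x n) := by
  induction n with
  | zero => exact hx0
  | succ n ih => rw [hrec n]; exact hPadd _ _ (hAP n _ ih) (hb n)

/-- [folklore] **THE LEVEL SUM (discrete Duhamel).**  For an affine recursion `x (j+1) = A j (x j) + b j` in an additive commutative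
group whose maps `A j` preserve a class `P ∋ 0` closed under `+` and are additive on it, with `x 0 ∈ P` and every `b j ∈ P`:
`x n = transport A 0 n (x 0) + Σ_{m ∈ range n} transport A (m+1) (n−1−m) (b m)` — the initial datum transported through all `n` levels
plus every level-`m` source transported from level `m+1` through the remaining `n−1−m` levels.  (Road «W3» (F1): the order-4 twin of
`E3UnitSplitSum.e3Of_succ_succ_decomp`; every composite transport displayed.) -/
theorem eq_transport_add_sum (hP0 : P 0) (hPadd : ∀ x y, P x → P y → P (x + y)) (hAP : ∀ j x, P x → P (A j x))
    (hAadd : ∀ j x y, P x → P y → A j (x + y) = A j x + A j y) {x b : ℕ → E} (hx0 : P (x 0)) (hb : ∀ j, P (b j))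
    (hrec : ∀ j, x (j + 1) = A j (x j) + b j) (n : ℕ) :
    x n = transport A 0 n (x 0) + ∑ m ∈ Finset.range n, transport A (m + 1) (n - 1 - m) (b m) := by
  induction n with
  | zero => simp
  | succ n ih =>
    have hmem : ∀ m ∈ Finset.range n, P (transport A (m + 1) (n - 1 - m) (b m)) :=
      fun m _ => transport_mem hAP _ _ (hb m)
    rw [hrec n, ih, hAadd n _ _ (transport_mem hAP 0 n hx0) (sum_mem hP0 hPadd _ _ hmem),
      map_sum_of_add hP0 hPadd (hAadd n) _ _ hmem, Finset.sum_range_succ, transport_succ, Nat.zero_add]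
    have hlast : transport A (n + 1) (n + 1 - 1 - n) (b n) = b n := by
      rw [show n + 1 - 1 - n = 0 by omega, transport_zero]
    rw [hlast, add_assoc]
    congr 2
    refine Finset.sum_congr rfl fun m hm => ?_
    have hm' : m < n := Finset.mem_range.mp hm
    rw [show n + 1 - 1 - m = (n - 1 - m) + 1 by omega, transport_succ]
    congr 1
    omega

end AddClass

/-! ## §3 Scalars out of the composite transport -/

section Smul

variable {R : Type*} [Semiring R] [AddCommMonoid E] [Module R E] {P : E → Prop}

/-- [folklore] **SCALARS OUT.**  If every `B j` is `R`-homogeneous on a class `P` preserved by the `B j`, then the transport of the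
rescaled family `j ↦ c • B j` through `k` steps is `c ^ k •` the transport of `B` (SKELETON-W3 (R12-3): the powers of the displayed
scalar — there `c = −cE₂·Lc^{2(d+1)}` — come OUT of the composite; nothing is hidden in a constant). -/
theorem transport_smul_eq {B : ℕ → E → E} (hBP : ∀ j x, P x → P (B j x))
    (hBsmul : ∀ j (r : R) x, P x → B j (r • x) = r • B j x) (c : R) (m k : ℕ) {x : E} (hx : P x) :
    transport (fun j y => c • B j y) m k x = c ^ k • transport B m k x := by
  induction k with
  | zero => simp
  | succ k ih =>
    rw [transport_succ, transport_succ, ih, hBsmul _ _ _ (transport_mem hBP m k hx), smul_smul, pow_succ']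

end Smul

/-! ## §4 The difference recursion ((F5), «T2SupRate») -/

section Diff

variable [AddCommGroup E] {A} {P : E → Prop}

/-- [folklore] **THE FORCING of the difference recursion**: `f n := (A (n+1) (x n) − A n (x n)) + (b (n+1) − b n)` — the one-step change
of the MAP read on the previous member (the Lipschitz-in-data × Cauchy-of-data socket) plus the one-step change of the SOURCE. -/
theorem diff_succ (hPsub : ∀ x y, P x → P y → P (x - y)) (hAadd : ∀ j x y, P x → P y → A j (x + y) = A j x + A j y)
    {x b : ℕ → E} (hxP : ∀ j, P (x j)) (hrec : ∀ j, x (j + 1) = A j (x j) + b j) (n : ℕ) :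
    x (n + 2) - x (n + 1) = A (n + 1) (x (n + 1) - x n) + ((A (n + 1) (x n) - A n (x n)) + (b (n + 1) - b n)) := by
  have hsplit : A (n + 1) (x (n + 1)) = A (n + 1) (x (n + 1) - x n) + A (n + 1) (x n) := by
    rw [← hAadd (n + 1) _ _ (hPsub _ _ (hxP (n + 1)) (hxP n)) (hxP n), sub_add_cancel]
  rw [hrec (n + 1), hsplit, hrec n]
  abel

/-- [folklore] **THE DIFFERENCE RECURSION UNROLLED.**  With `D n := x (n+1) − x n` and the forcing `f` of `diff_succ`,
`D n = transport A 1 n (D 0) + Σ_{m ∈ range n} transport A (m+2) (n−1−m) (f m)` (SKELETON-W3 §7.4 (F5): «`D(n+1) = 𝒜 D(n) + f_n` unrolled»;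
the maps of the difference recursion are the SHIFTED family `j ↦ A (j+1)`). -/
theorem diff_eq_transport_add_sum (hP0 : P 0) (hPadd : ∀ x y, P x → P y → P (x + y)) (hPsub : ∀ x y, P x → P y → P (x - y))
    (hAP : ∀ j x, P x → P (A j x)) (hAadd : ∀ j x y, P x → P y → A j (x + y) = A j x + A j y) {x b : ℕ → E}
    (hx0 : P (x 0)) (hb : ∀ j, P (b j)) (hrec : ∀ j, x (j + 1) = A j (x j) + b j) (n : ℕ) :
    x (n + 1) - x n = transport A 1 n (x 1 - x 0) +
      ∑ m ∈ Finset.range n, transport A (m + 2) (n - 1 - m) ((A (m + 1) (x m) - A m (x m)) + (b (m + 1) - b m)) := by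
  have hxP : ∀ j, P (x j) := mem_of_rec hPadd hAP hx0 hb hrec
  -- the difference sequence obeys the affine recursion with the shifted maps
  have hD := eq_transport_add_sum (A := fun j => A (j + 1)) (P := P) (x := fun j => x (j + 1) - x j)
    (b := fun j => (A (j + 1) (x j) - A j (x j)) + (b (j + 1) - b j)) hP0 hPadd (fun j y hy => hAP (j + 1) y hy)
    (fun j y z hy hz => hAadd (j + 1) y z hy hz) (hPsub _ _ (hxP 1) (hxP 0))
    (fun j => hPadd _ _ (hPsub _ _ (hAP _ _ (hxP j)) (hAP _ _ (hxP j))) (hPsub _ _ (hb (j + 1)) (hb j)))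
    (fun j => diff_succ hPsub hAadd hxP hrec j) n
  simp only [transport_shift] at hD
  simpa [Nat.zero_add] using hD

end Diff

end Summit.QuantumFields.BalabanUV.Beta.GAN24.AffineUnroll
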